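import Mathlib
import Summits.MatrixMultiplication.MatrixMultiplication.Theorems.HiddenToeplitzCornersHiddenCornerLemmaRInverseDisplacement
import Summits.MatrixMultiplication.MatrixMultiplication.Theorems.HiddenToeplitzCornersHiddenCornerLemmaRLeftInverseKit
import Summits.MatrixMultiplication.MatrixMultiplication.Theorems.HiddenToeplitzCornersHiddenCornerLemmaRDefectBoundE
import Summits.MatrixMultiplication.MatrixMultiplication.Theorems.HiddenToeplitzCornersHiddenCornerLemmaRDefectBoundF
import Summits.MatrixMultiplication.MatrixMultiplication.Theorems.HiddenToeplitzCornersHiddenCornerLemmaRGoodPoint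

/-!
# Hidden-corner lemma: the two intrinsic defect bounds (Theorems 1 and 2)

Support file for crux item `stmt-MatrixMultiplication-10752`
(`Summit.MatrixMultiplication.MatrixMultiplication.Theses.HiddenToeplitzCorners.HiddenCornerLemmaR`).

Under the crux hypotheses — a pencil `T(X) = Σ X a b • T a b` of Stein displacement rank `≤ d` for the
lower shift `Z`, hiding the linearly explained corner `T(X) E = F X` with `rank E = rank F = r` — we
assemble the registered pieces (`LeftInverseKit`, `DefectBoundE`, `InverseDisplacement`,
`GoodPoint`, `DefectBoundF`) into the two INTRINSIC inequalities of the corner-adapted analysis: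

* `hclR_two_r_le_E` (Theorem 1, no nonsingularity): `2 r ≤ d + rank [E | Zᵀ E]`;
* `hclR_two_r_le_F` (Theorem 2, uses a nonsingular value): `2 r ≤ d + rank [F | Z F]`.

Equivalently `r ≤ d + β_E` and `r ≤ d + α_F` with the shift defects `β_E = dim(im E + Zᵀ im E) − r`,
`α_F = dim(im F + Z im F) − r`.  (The companion transfer `α_F ≤ d` is FALSE in general — lead's
evidence LEAD-NOTES-r1.md on the item — so these bounds do not close the crux by themselves.)
-/

set_option linter.dupNamespace false

namespace Summit.MatrixMultiplication.MatrixMultiplication.Theorems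

open Matrix BigOperators

/-- **Theorem 1 (E-side defect bound).** For a pencil of Stein displacement rank `≤ d` (lower shift
`Z`) hiding `T(X) E = F X` with `rank E = rank F = r`: `2 r ≤ d + rank [E | Zᵀ E]`. -/
theorem hclR_two_r_le_E (r N d : ℕ) (T : Fin r → Fin r → Matrix (Fin N) (Fin N) ℂ)
    (E F : Matrix (Fin N) (Fin r) ℂ) (hE : E.rank = r) (hF : F.rank = r)
    (hcorner : ∀ X : Matrix (Fin r) (Fin r) ℂ, (∑ a : Fin r, ∑ b : Fin r, X a b • T a b) * E = F * X)
    (hdisp : ∀ X : Matrix (Fin r) (Fin r) ℂ, ((∑ a : Fin r, ∑ b : Fin r, X a b • T a b) -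
        (Matrix.of fun i j : Fin N => if (i : ℕ) = (j : ℕ) + 1 then (1 : ℂ) else 0) *
        (∑ a : Fin r, ∑ b : Fin r, X a b • T a b) *
        (Matrix.of fun i j : Fin N => if (i : ℕ) = (j : ℕ) + 1 then (1 : ℂ) else 0)ᵀ).rank ≤ d) :
    2 * r ≤ d + (Matrix.fromCols E ((Matrix.of fun i j : Fin N => if (i : ℕ) = (j : ℕ) + 1 then (1 : ℂ) else 0)ᵀ * E)).rank := by
  obtain ⟨ΛF, hΛF, hnil⟩ := hclR_exists_leftInv_nilpotent_shift F hF
  obtain ⟨ΛE, hΛE, -⟩ := hclR_exists_leftInv_nilpotent_shiftT E hE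
  have h1 := hclR_defect_bound_E r N d T E F ΛE hΛE ΛF hΛF hnil hcorner hdisp
  have h2 := hclR_rank_fromCols_eq_add E ΛE hΛE
    ((Matrix.of fun i j : Fin N => if (i : ℕ) = (j : ℕ) + 1 then (1 : ℂ) else 0)ᵀ * E)
  rw [← Matrix.mul_assoc] at h2
  omega

/-- **Theorem 2 (F-side defect bound).** Under the hypotheses of Theorem 1 plus a nonsingular value
`det T(X₀) ≠ 0`: `2 r ≤ d + rank [F | Z F]`.  (The inverse family `T(X)⁻¹` hides `E X⁻¹ = T⁻¹ F`
and is Toeplitz-like for the swapped pair by `hclR_inv_displacement_le`; evaluate the `(1,1)` block at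
the good point of `hclR_exists_good_point`.) -/
theorem hclR_two_r_le_F (r N d : ℕ) (T : Fin r → Fin r → Matrix (Fin N) (Fin N) ℂ)
    (E F : Matrix (Fin N) (Fin r) ℂ) (hE : E.rank = r) (hF : F.rank = r)
    (hcorner : ∀ X : Matrix (Fin r) (Fin r) ℂ, (∑ a : Fin r, ∑ b : Fin r, X a b • T a b) * E = F * X)
    (hdisp : ∀ X : Matrix (Fin r) (Fin r) ℂ, ((∑ a : Fin r, ∑ b : Fin r, X a b • T a b) -
        (Matrix.of fun i j : Fin N => if (i : ℕ) = (j : ℕ) + 1 then (1 : ℂ) else 0) *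
        (∑ a : Fin r, ∑ b : Fin r, X a b • T a b) *
        (Matrix.of fun i j : Fin N => if (i : ℕ) = (j : ℕ) + 1 then (1 : ℂ) else 0)ᵀ).rank ≤ d)
    (hns : ∃ X₀ : Matrix (Fin r) (Fin r) ℂ, (∑ a : Fin r, ∑ b : Fin r, X₀ a b • T a b).det ≠ 0) :
    2 * r ≤ d + (Matrix.fromCols F ((Matrix.of fun i j : Fin N => if (i : ℕ) = (j : ℕ) + 1 then (1 : ℂ) else 0) * F)).rank := by
  set Z := (Matrix.of fun i j : Fin N => if (i : ℕ) = (j : ℕ) + 1 then (1 : ℂ) else 0) with hZ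
  obtain ⟨ΛF, hΛF, -⟩ := hclR_exists_leftInv_nilpotent_shift F hF
  obtain ⟨ΛE, hΛE, hnilE⟩ := hclR_exists_leftInv_nilpotent_shiftT E hE
  -- displacement bound for the inverse family
  have hinv : ∀ X : Matrix (Fin r) (Fin r) ℂ, IsUnit (∑ a : Fin r, ∑ b : Fin r, X a b • T a b).det →
      ((∑ a : Fin r, ∑ b : Fin r, X a b • T a b)⁻¹ - Zᵀ * (∑ a : Fin r, ∑ b : Fin r, X a b • T a b)⁻¹ * Z).rank ≤ d := by
    intro X hX
    exact hclR_inv_displacement_le _ hX (hdisp X)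
  -- nonsingular values force X invertible
  have hinj : ∀ X : Matrix (Fin r) (Fin r) ℂ, (∑ a : Fin r, ∑ b : Fin r, X a b • T a b).det ≠ 0 → IsUnit X.det := by
    intro X hX
    set TX := ∑ a : Fin r, ∑ b : Fin r, X a b • T a b with hTX
    by_contra hXu
    have hXdet : X.det = 0 := by
      by_contra h; exact hXu (isUnit_iff_ne_zero.mpr h)
    obtain ⟨v, hv, hXv⟩ := Matrix.exists_mulVec_eq_zero_iff.mpr hXdet
    have h1 : TX *ᵥ (E *ᵥ v) = 0 := by
      rw [Matrix.mulVec_mulVec, hcorner X, ← Matrix.mulVec_mulVec, hXv, Matrix.mulVec_zero]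
    have hTu : IsUnit TX.det := isUnit_iff_ne_zero.mpr hX
    have h2 : E *ᵥ v = 0 := by
      calc E *ᵥ v = (TX⁻¹ * TX) *ᵥ (E *ᵥ v) := by rw [Matrix.nonsing_inv_mul _ hTu, Matrix.one_mulVec]
        _ = TX⁻¹ *ᵥ (TX *ᵥ (E *ᵥ v)) := by simp only [Matrix.mulVec_mulVec, Matrix.mul_assoc]
        _ = 0 := by rw [h1, Matrix.mulVec_zero]
    have h3 : v = 0 := by
      calc v = (ΛE * E) *ᵥ v := by rw [hΛE, Matrix.one_mulVec]
        _ = ΛE *ᵥ (E *ᵥ v) := by simp only [Matrix.mulVec_mulVec]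
        _ = 0 := by rw [h2, Matrix.mulVec_zero]
    exact hv h3
  obtain ⟨X, hXu, hgoodX⟩ := hclR_exists_good_point r N T (ΛF * Z * F) (ΛE * Zᵀ * E) hnilE hns hinj
  have h1 := hclR_defect_bound_F r N d T E F ΛE hΛE ΛF hΛF hcorner hinv ⟨X, hXu, hgoodX⟩
  rw [← hZ] at h1
  have h2 := hclR_rank_fromCols_eq_add F ΛF hΛF (Z * F)
  rw [← Matrix.mul_assoc] at h2
  omega

end Summit.MatrixMultiplication.MatrixMultiplication.Theorems
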